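import Summits.FinalStateConjecture.FinalStateConjecture.Theses.ZeroEnergyKerrOrBomb
import Summits.FinalStateConjecture.FinalStateConjecture.Theorems.ErgoregionBomb.Negative.GrowthLaw
import Summits.FinalStateConjecture.FinalStateConjecture.Theorems.ZeroEnergyRigidity.Negative.KillingNonvanishingOfGH
import Literature.Geometry.Lorentzian.KillingModeStability
import Literature.Geometry.Lorentzian.StationaryBlackHoleUniquenessProofs

/-!
# `KerrOrBomb` (crux `stmt-FinalStateConjecture-10689`, route `ZeroEnergyKerrOrBomb`):
# anatomy of the mode-stability hypothesis (negative-side load-bearing analysis)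

Support file of the crux disprover (cdisprove seat `refuter-cdisprove-stmt-FinalStateConjecture-10689-0`,
cycle 1, 2026-08-16), `sorry`-free; workfile `Cruxes/KerrOrBomb/Disproof.lean` §1–§2.  The crux
reads `∀ 𝓑, h1 vacuum → h2 𝓔⁺ connected → h3 𝓔⁺ non-degenerate → h4 globally hyperbolic →
h5 (T ≠ 0 on doc) → h6 𝓑.IsKillingModeStable → d.o.c. ≅ sub-extremal Kerr exterior`, where
`IsKillingModeStable` (`Literature/…/KillingModeStability.lean`, inlined verbatim in the item) says:
every Killing-mode pair `(ψ, χ)` of frequency `ν + iω` with `0 < ν` — smooth near `doc ∪ 𝓔⁺`,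
`□ψ = □χ = 0` and `dψ(T) = νψ − ωχ`, `dχ(T) = ωψ + νχ` on the d.o.c., bounded on
`doc ∩ I⁻(embed '' e.far (e.R + 1))` — vanishes on the d.o.c.  This file records, for EVERY
presentation `𝓑 : StationaryAFBlackHole`:

* `kerrOrBomb_iff_withoutH5` — h5 is decoration (implied by h4: landed
  `killing_ne_zero_of_mem_doc_of_isGloballyHyperbolic`, Chruściel–Costa 2008 Cor. 3.8);
* `isKillingModePair_const`, `exists_isKillingModePair_nonneg_ne_zero` — with `0 < ν` weakened to
  `0 ≤ ν` the hypothesis h6 FAILS everywhere (constant pair `(1, 0)`, `doc ≠ ∅`): strict growth is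
  the only teeth of the mode notion;
* `isKillingModePair_swap`, `isKillingModeStable_iff_nonneg_omega` — `(ψ, χ, ω) ↦ (χ, ψ, −ω)` is a
  symmetry of the mode class; WLOG `0 ≤ ω`;
* `modePair_eq_zero_of_bounded_on_doc`, `isKillingModeStable_docBounded` — UNCONDITIONALLY (landed
  growth law `modePair_sq_eq_exp` + flow-invariance of `⟨⟨M_ext⟩⟩`,
  `StationaryAFBlackHole.mem_doc_of_isMIntegralCurve`), a `ν > 0` pair bounded on the WHOLE d.o.c.
  vanishes there: h6 with its boundedness region widened to `doc` is a tautology (so the crux with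
  that h6 is the full smooth uniqueness statement), i.e. the restriction of the bound to the past of
  the far slice region is load-bearing;
* `modePair_eq_zero_of_closed_orbit`, `isKillingModeStable_of_closed_orbits` — if the stationary
  orbits through the d.o.c. are CLOSED, h6 holds with no wave equation and no bound
  (`e^{2νL} = 1` is impossible): time-periodic identifications (`Kerr/ℤ_L`, which satisfies h1 h2 h3
  h5 and falsifies the conclusion by `π₁`) are invisible to mode stability and are excluded from the
  crux by the chronology clause of h4 alone.

References: B. F. Whiting, J. Math. Phys. 30 (1989) 1301; Y. Shlapentokh-Rothman, AHP 16 (2015)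
289, Def. 1.1, §1.3; P. T. Chruściel, J. L. Costa, Astérisque 321 (2008), §2.2 and Cor. 3.8.
-/

noncomputable section

set_option linter.dupNamespace false
-- instance search through nested operator types `E →L E →L ℝ` (as in the tree files)
set_option maxSynthPendingDepth 3

namespace Summit.FinalStateConjecture.FinalStateConjecture.Theorems.KerrOrBomb.Negative

open Set Literature.Geometry.Lorentzian
open scoped Manifold Topology
open Summit.FinalStateConjecture.FinalStateConjecture.Theses.ZeroEnergyKerrOrBomb (KerrOrBomb)

/-! ## h5 is decoration -/

/-- **`KerrOrBomb` is equivalent to itself with h5 deleted** (the right-hand side is the served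
statement of `stmt-FinalStateConjecture-10689` with the binder `(∀ p ∈ 𝓑.doc, 𝓑.killing p ≠ 0) →`
removed and h6 spelled by name, `isKillingModeStable_iff` being `Iff.rfl`).  Pure logic over the
landed `killing_ne_zero_of_mem_doc_of_isGloballyHyperbolic` (h4 ⇒ h5). [cite: ChruscielCosta2008, Cor. 3.8] -/
theorem kerrOrBomb_iff_withoutH5 :
    KerrOrBomb ↔
      ∀ (𝓑 : StationaryAFBlackHole.{0}) [𝓑.metric.HasLeviCivita] [Kerr.Facts],
        𝓑.metric.toPseudoRiemannianMetric.IsRicciFlat → IsConnected 𝓑.horizon →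
        𝓑.toSpacetime.IsNonDegenerateHorizon 𝓑.Mext →
        𝓑.metric.IsGloballyHyperbolic 𝓑.timeOrientation → 𝓑.IsKillingModeStable →
        ∃ (M a : ℝ), Kerr.IsSubextremal M a ∧ ∃ Ψ : Kerr.exterior M a → 𝓑.carrier,
          Function.Injective Ψ ∧ Set.range Ψ = 𝓑.doc ∧
            PseudoRiemannianMetric.IsIsometricImmersion
              (Kerr.smoothMetric M a (Kerr.rPlus M a)).toPseudoRiemannianMetric
              𝓑.metric.toPseudoRiemannianMetric Ψ :=
  ⟨fun h 𝓑 _ _ h1 h2 h3 h4 h6 ↦ h 𝓑 h1 h2 h3 h4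
      (fun _ hp ↦ ZeroEnergyRigidity.Negative.killing_ne_zero_of_mem_doc_of_isGloballyHyperbolic
        𝓑 h4 hp) h6,
    fun h 𝓑 _ _ h1 h2 h3 h4 _ h6 ↦ h 𝓑 h1 h2 h3 h4 h6⟩

variable (𝓑 : StationaryAFBlackHole.{0}) [𝓑.metric.HasLeviCivita]

/-! ## The only teeth on the hypothesis side of h6 is `0 < ν` -/

/-- Constant pairs `(c, 0)` are Killing-mode pairs of frequency `0` (constants are smooth, solve
`□_g ψ = 0` by `PseudoRiemannianMetric.dalembertian_const`, have `dψ(T) = 0`, are bounded). [folklore] -/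
theorem isKillingModePair_const (c : ℝ) : 𝓑.IsKillingModePair 0 0 (fun _ ↦ c) (fun _ ↦ 0) := by
  refine ⟨⟨univ, isOpen_univ, subset_univ _, contMDiffOn_const, contMDiffOn_const⟩,
    fun x _ ↦ ⟨?_, ?_⟩, fun x _ ↦ ?_, ⟨|c|, fun x _ ↦ by simp⟩⟩
  · exact PseudoRiemannianMetric.dalembertian_const _ c x
  · exact PseudoRiemannianMetric.dalembertian_const _ 0 x
  · have h0 : mfderiv (𝓡 4) 𝓘(ℝ, ℝ) (fun _ : 𝓑.carrier ↦ (0 : ℝ)) x = 0 := mfderiv_const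
    have hc : mfderiv (𝓡 4) 𝓘(ℝ, ℝ) (fun _ : 𝓑.carrier ↦ c) x = 0 := mfderiv_const
    refine ⟨?_, ?_⟩ <;>
      simp only [h0, hc, zero_apply, zero_mul, mul_zero, sub_self, add_zero] <;> rfl

/-- **With `0 < ν` weakened to `0 ≤ ν`, h6 fails on every presentation**: the constant pair
`(1, 0)` of frequency `0` is a Killing-mode pair which does not vanish on the (non-empty,
`StationaryAFBlackHole.doc_nonempty`) d.o.c.  Hence the crux with that weakened h6 is vacuously
true, and any use of h6 must exploit STRICT exponential growth. [cite: ChruscielCosta2008, §2.2 (2.2)] -/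
theorem exists_isKillingModePair_nonneg_ne_zero :
    ∃ (ν ω : ℝ) (ψ χ : 𝓑.carrier → ℝ), 0 ≤ ν ∧ 𝓑.IsKillingModePair ν ω ψ χ ∧
      ∃ x ∈ 𝓑.doc, ψ x ≠ 0 ∨ χ x ≠ 0 := by
  obtain ⟨x₀, hx₀⟩ := 𝓑.doc_nonempty
  exact ⟨0, 0, fun _ ↦ 1, fun _ ↦ 0, le_rfl, isKillingModePair_const 𝓑 1, x₀, hx₀,
    Or.inl one_ne_zero⟩

/-! ## Normal form `0 ≤ ω` -/

variable {𝓑} in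
/-- **Swap symmetry of the mode class**: if `(ψ, χ)` is a Killing-mode pair of frequency `ν + iω`
then `(χ, ψ)` is one of frequency `ν − iω` (`Ψ ↦ iΨ̄`; only real arithmetic in the
eigen-equations, the other three clauses are symmetric in `ψ, χ`). [folklore] -/
theorem isKillingModePair_swap {ν ω : ℝ} {ψ χ : 𝓑.carrier → ℝ} (h : 𝓑.IsKillingModePair ν ω ψ χ) :
    𝓑.IsKillingModePair ν (-ω) χ ψ := by
  obtain ⟨⟨U, hU, hsub, hψ, hχ⟩, hW, hE, ⟨C, hC⟩⟩ := h
  refine ⟨⟨U, hU, hsub, hχ, hψ⟩, fun x hx ↦ ⟨(hW x hx).2, (hW x hx).1⟩, fun x hx ↦ ⟨?_, ?_⟩,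
    ⟨C, fun x hx ↦ ⟨(hC x hx).2, (hC x hx).1⟩⟩⟩
  · have h2 : (mfderiv (𝓡 4) 𝓘(ℝ, ℝ) χ x (𝓑.killing x) : ℝ) = ω * ψ x + ν * χ x := (hE x hx).2
    show (mfderiv (𝓡 4) 𝓘(ℝ, ℝ) χ x (𝓑.killing x) : ℝ) = ν * χ x - (-ω) * ψ x
    rw [h2]; ring
  · have h1 : (mfderiv (𝓡 4) 𝓘(ℝ, ℝ) ψ x (𝓑.killing x) : ℝ) = ν * ψ x - ω * χ x := (hE x hx).1
    show (mfderiv (𝓡 4) 𝓘(ℝ, ℝ) ψ x (𝓑.killing x) : ℝ) = (-ω) * χ x + ν * ψ x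
    rw [h1]; ring

/-- **Normal form of mode stability**: it suffices to kill the Killing-mode pairs with `0 ≤ ω`.
[folklore] -/
theorem isKillingModeStable_iff_nonneg_omega : 𝓑.IsKillingModeStable ↔
    ∀ (ν ω : ℝ) (ψ χ : 𝓑.carrier → ℝ), 0 < ν → 0 ≤ ω → 𝓑.IsKillingModePair ν ω ψ χ →
      ∀ x ∈ 𝓑.doc, ψ x = 0 ∧ χ x = 0 := by
  rw [StationaryAFBlackHole.isKillingModeStable_iff_forall_isKillingModePair]
  refine ⟨fun h ν ω ψ χ hν _ hp ↦ h ν ω ψ χ hν hp, fun h ν ω ψ χ hν hp x hx ↦ ?_⟩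
  rcases le_or_gt 0 ω with hω | hω
  · exact h ν ω ψ χ hν hω hp x hx
  · exact (h ν (-ω) χ ψ hν (by linarith) (isKillingModePair_swap hp) x hx).symm

/-! ## The boundedness REGION is load-bearing -/

variable {𝓑} in
/-- **No `ν > 0` pair is bounded on the whole d.o.c.** — unconditional form of the landed
`ErgoregionBomb.Negative.modePair_eq_zero_of_bounded_on_doc`, its forward-invariance hypothesis
discharged by `StationaryAFBlackHole.mem_doc_of_isMIntegralCurve` (the stationary flow preserves
`⟨⟨M_ext⟩⟩`).  Neither the wave equation nor any of h1–h5 is used. [cite: ChruscielCosta2008, §2.2 (2.2)] -/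
theorem modePair_eq_zero_of_bounded_on_doc {ν ω : ℝ} {ψ χ : 𝓑.carrier → ℝ} (hν : 0 < ν)
    (hU : ∃ U : Set 𝓑.carrier, IsOpen U ∧ 𝓑.doc ∪ 𝓑.horizon ⊆ U ∧
      ContMDiffOn (𝓡 4) 𝓘(ℝ, ℝ) ((⊤ : ℕ∞) : WithTop ℕ∞) ψ U ∧
      ContMDiffOn (𝓡 4) 𝓘(ℝ, ℝ) ((⊤ : ℕ∞) : WithTop ℕ∞) χ U)
    (heig : ∀ x ∈ 𝓑.doc, mfderiv (𝓡 4) 𝓘(ℝ, ℝ) ψ x (𝓑.killing x) = ν * ψ x - ω * χ x ∧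
      mfderiv (𝓡 4) 𝓘(ℝ, ℝ) χ x (𝓑.killing x) = ω * ψ x + ν * χ x)
    (hb : ∃ C : ℝ, ∀ x ∈ 𝓑.doc, |ψ x| ≤ C ∧ |χ x| ≤ C) :
    ∀ x ∈ 𝓑.doc, ψ x = 0 ∧ χ x = 0 :=
  ErgoregionBomb.Negative.modePair_eq_zero_of_bounded_on_doc 𝓑
    (fun _ hσ h0 t _ ↦ StationaryAFBlackHole.mem_doc_of_isMIntegralCurve hσ h0 t) hν hU heig hb

/-- **h6 with its boundedness region widened to the whole d.o.c. holds on EVERY presentation**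
(the clause `doc ∩ I⁻(embed '' e.far (e.R + 1))` replaced by `doc`; everything else verbatim).
So that widening turns the crux into full smooth uniqueness: the restriction of the bound to the
past of the far slice region is load-bearing. [folklore] -/
theorem isKillingModeStable_docBounded :
    ∀ (ν ω : ℝ) (ψ χ : 𝓑.carrier → ℝ), 0 < ν →
      (∃ U : Set 𝓑.carrier, IsOpen U ∧ 𝓑.doc ∪ 𝓑.horizon ⊆ U ∧
        ContMDiffOn (𝓡 4) 𝓘(ℝ, ℝ) ((⊤ : ℕ∞) : WithTop ℕ∞) ψ U ∧
          ContMDiffOn (𝓡 4) 𝓘(ℝ, ℝ) ((⊤ : ℕ∞) : WithTop ℕ∞) χ U) →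
      (∀ x ∈ 𝓑.doc, 𝓑.metric.dalembertian ψ x = 0 ∧ 𝓑.metric.dalembertian χ x = 0) →
      (∀ x ∈ 𝓑.doc, mfderiv (𝓡 4) 𝓘(ℝ, ℝ) ψ x (𝓑.killing x) = ν * ψ x - ω * χ x ∧
        mfderiv (𝓡 4) 𝓘(ℝ, ℝ) χ x (𝓑.killing x) = ω * ψ x + ν * χ x) →
      (∃ C : ℝ, ∀ x ∈ 𝓑.doc, |ψ x| ≤ C ∧ |χ x| ≤ C) →
      ∀ x ∈ 𝓑.doc, ψ x = 0 ∧ χ x = 0 :=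
  fun _ _ _ _ hν hU _ heig hb ↦ modePair_eq_zero_of_bounded_on_doc hν hU heig hb

/-! ## Closed stationary orbits make h6 automatic -/

variable {𝓑} in
omit [𝓑.metric.HasLeviCivita] in
/-- **A `ν > 0` pair vanishes on every CLOSED stationary orbit** along which the eigen-equations
hold: `(ψ² + χ²)(σ L) = e^{2νL}(ψ² + χ²)(σ 0)` by the landed growth law `modePair_sq_eq_exp`, and
`σ L = σ 0`, `1 < e^{2νL}`.  No boundedness, no wave equation. [folklore] -/
theorem modePair_eq_zero_of_closed_orbit {σ : ℝ → 𝓑.carrier} (hσ : IsMIntegralCurve σ 𝓑.killing)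
    {L : ℝ} (hL : 0 < L) (hper : σ L = σ 0) {ν ω : ℝ} {ψ χ : 𝓑.carrier → ℝ} (hν : 0 < ν)
    (hd : ∀ t, MDifferentiableAt (𝓡 4) 𝓘(ℝ, ℝ) ψ (σ t) ∧ MDifferentiableAt (𝓡 4) 𝓘(ℝ, ℝ) χ (σ t))
    (heig : ∀ t, mfderiv (𝓡 4) 𝓘(ℝ, ℝ) ψ (σ t) (𝓑.killing (σ t)) = ν * ψ (σ t) - ω * χ (σ t) ∧
      mfderiv (𝓡 4) 𝓘(ℝ, ℝ) χ (σ t) (𝓑.killing (σ t)) = ω * ψ (σ t) + ν * χ (σ t)) :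
    ψ (σ 0) = 0 ∧ χ (σ 0) = 0 := by
  have hgrow := ErgoregionBomb.Negative.modePair_sq_eq_exp 𝓑 hσ Set.ordConnected_univ
    (fun t _ ↦ hd t) (fun t _ ↦ heig t) (Set.mem_univ 0) (Set.mem_univ L)
  rw [hper, sub_zero] at hgrow
  have hexp : 1 < Real.exp (2 * ν * L) := Real.one_lt_exp_iff.2 (by positivity)
  have hψ0 : ψ (σ 0) ^ 2 = 0 := by nlinarith [sq_nonneg (ψ (σ 0)), sq_nonneg (χ (σ 0))]
  have hχ0 : χ (σ 0) ^ 2 = 0 := by nlinarith [sq_nonneg (ψ (σ 0)), sq_nonneg (χ (σ 0))]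
  exact ⟨pow_eq_zero_iff (n := 2) (by norm_num) |>.mp hψ0,
    pow_eq_zero_iff (n := 2) (by norm_num) |>.mp hχ0⟩

/-- **Presentations whose stationary orbits through the d.o.c. are closed are Killing-mode stable
for free** (growth law on one period; the orbit stays in the d.o.c. by
`StationaryAFBlackHole.mem_doc_of_isMIntegralCurve`, where the pair is differentiable and the
eigen-equations hold).  This is why the `t*`-periodic quotient `Kerr/ℤ_L` — h1 h2 h3 h5 true,
conclusion false by `π₁` — is mode-stable as typed and is excluded from the crux by the chronology
clause of h4 only. [folklore] -/
theorem isKillingModeStable_of_closed_orbits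
    (hcl : ∀ x ∈ 𝓑.doc, ∃ (σ : ℝ → 𝓑.carrier) (L : ℝ),
      IsMIntegralCurve σ 𝓑.killing ∧ σ 0 = x ∧ 0 < L ∧ σ L = σ 0) :
    𝓑.IsKillingModeStable := by
  intro ν ω ψ χ hν hU _ heig _ x hx
  obtain ⟨U, hUo, hsub, hψ, hχ⟩ := hU
  obtain ⟨σ, L, hσ, hσ0, hL, hper⟩ := hcl x hx
  have hdoc : ∀ t, σ t ∈ 𝓑.doc := fun t ↦
    StationaryAFBlackHole.mem_doc_of_isMIntegralCurve hσ (hσ0 ▸ hx) t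
  have hd : ∀ t, MDifferentiableAt (𝓡 4) 𝓘(ℝ, ℝ) ψ (σ t) ∧
      MDifferentiableAt (𝓡 4) 𝓘(ℝ, ℝ) χ (σ t) := fun t ↦ by
    have hmem : U ∈ 𝓝 (σ t) := hUo.mem_nhds (hsub (Or.inl (hdoc t)))
    exact ⟨(hψ.contMDiffAt hmem).mdifferentiableAt (by simp),
      (hχ.contMDiffAt hmem).mdifferentiableAt (by simp)⟩
  have h := modePair_eq_zero_of_closed_orbit hσ hL hper hν hd (fun t ↦ heig (σ t) (hdoc t))
  rwa [hσ0] at h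

end Summit.FinalStateConjecture.FinalStateConjecture.Theorems.KerrOrBomb.Negative

end
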